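import Summits.BirchSwinnertonDyer.BirchSwinnertonDyer.Theorems.SprungSharpFlatMainConjectureEdges
import Summits.BirchSwinnertonDyer.BirchSwinnertonDyer.Theorems.SignedLowerHalvesSprungLowerHalfAtThreeChromaticReduction
import Summits.BirchSwinnertonDyer.Rank1Residual.Supersingular.KobayashiSqueezeReal
import Literature.NumberTheory.EllipticCurves.Sprung2012.SharpFlatKatoDivisibility
import Literature.NumberTheory.EllipticCurves.BurungaleTian2026.EtaSignedMainConjectureTensorQ
import HarnessLib

/-!
# Corner X8, the small-image residual of route `PrintX8` (crux `SharpFlatMainConjectureSmallImageX8`,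
# stmt-BirchSwinnertonDyer-20402) read `Λ`-adically, PER PAIR: given K1's predicate, on EVERY X8 pair
# `char_Λ X^•(E/ℚ_∞) = (3^m · L^•_3(E))` EXACTLY, and Sprung's Main Conjecture 7.21 IS the
# `μ`-inequality `μ(X^•) ≤ μ(Λ/(L^•))` (cell `bsd-print-x8`, D-0131 (2) print tier, prover seat p3;
# `--supports` 20402, closes nothing)

PARTITION (cell bsd-print-x8, leaf `ClassX8` = K3 row A8 = W-ALL row 8; census `A8_x8_open_cells.v3.tsv`,
217 cells: 156 with `ρ̄_{E,3}` surjective, 61 with image the normaliser of a non-split Cartan `N_ns(3)`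
— ty3's `x8_smallimage_61cells.tsv`, 60 of analytic rank `0` and 1 of rank `1`): types-the-object-of the
small-image crux on ALL X8 pairs (rank-free, image-free); closes NONE; 0 census cells move; BSD is not
proved by any of this.

HONEST FRAMING. Seat p3 carries «does BSTW 2024 cover `a_p ≠ 0` at `p = 3`? read §1 at the page: NO ⇒
the exact missing input is the crux». The NO was delivered (arXiv:2409.01350v2 (1.7) `a_3 = 0`, authors'
§1.5; kernel `ClassX8.not_bstw_h4`) and the missing input named BY ITEM: the Eisenstein half K1 =
`SprungLowerDivisibilityAtThree` (stmt-19875, shared with K3). Route `PrintX8` (rev 6) then isolated ONE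
further residual, `SharpFlatMainConjectureSmallImageX8` (stmt-20402): the full ♯/♭ main conjecture on the
X8 pairs with NON-surjective `ρ̄_{E,3}`, «where no integral Kato divisibility is in print» (Sprung 2012
Thm. 7.16 gives `Char X^• ⊇ (3ⁿ L^•)` with `n = 0` only under `GL₂(ℤ₃)`-surjectivity; Kato's (12.5.2)).
THIS file says EXACTLY what that residual is, beyond K1, in the kernel:

* §0 (`Λ`-algebra). In `Λ = ℤ_3⟦T⟧` (`3` prime: `IwasawaAlgebra.prime_C`), `gen = C(u)·L·h` with
  `gen ∣ 3ⁿ·L`, `L ≠ 0` forces `(gen) = (3^m · L)` for some `m ≤ n` (`dvd_prime_pow`); and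
  `μ(M) = m + μ(Λ/(L))` when `char M = (3^m L)` (tree `μ`-calculus of
  `BurungaleTian2026/EtaSignedMainConjectureTensorQ.lean`: `muInvariant_quotient_pow_mul`,
  `muInvariant_eq_muInvariant_quotient_of_charIdeal_eq_span`).
* §1 (per pair, ANY `3`-adic image, ANY analytic rank, colour `•` with `L^• ≠ 0`). K1's predicate
  `Theorems.SprungSharpFlatLowerDivisibility W 3 •` + Sprung 2012 Thm. 7.14 (`h714`) + Thm. 7.16 FIRST
  clause (`h716`, NO image hypothesis) + the period unit at `3` (`h3`) ⇒ for every cyclotomic / Honda /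
  newform / Sprung-pair / dual datum: **`char X^• = (3^m · L^•_3(E))` for some `m`**, and
  **`μ(X^•) = m + μ(Λ/(L^•))`** — so K1 is the `μ`-LOWER bound and the exponent `m` is the whole residual
  (`X8.exists_charIdeal_eq_span_pow_mul_of_lowerDivisibility`,
  `X8.exists_charIdeal_eq_and_muInvariant_eq_of_lowerDivisibility`).
* §1b (the `μ`-criterion). GIVEN K1's predicate: **Sprung's Main Conjecture 7.21 for `•`
  (`Theorems.SprungSharpFlatMainConjecture W 3 •`, Néron-normalised, on the REAL `X^•`) ⟺
  `μ(X^•) ≤ μ(Λ/(L^•))` for every datum ⟺ `μ(X^•) = μ(Λ/(L^•))` for every datum**; in particular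
  `μ(X^•(E/ℚ_∞)) = 0` suffices (`…_of_muInvariant_eq_zero`); and MC ⇒ the `μ`-equality needs no K1.
  On the big-image branch the `μ`-equality is a THEOREM given K1 (Kato `n = 0` by Wuthrich 2014 Lemma
  20; p534029), so the `μ`-bound is a residual ONLY on the 61 `N_ns(3)` cells; that remark and the CLASS
  forms (20402 ⟺ K1-on-small-image ∧ `μ`-bound: the glue for a split of 20402; at analytic rank `0`
  the `μ`-bound ⟺ `BSD(E,3)`) are the sibling file `PrintX8SmallImageMuSplit.lean`. WHAT THIS IS NOT: not a proof of the `μ`-bound, not an engine for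
the 61 cells, not a claim that `μ = 0` is in print at `a_3 = ±3` (it is not: the ♯/♭ `μ`-transfer à la
Greenberg–Vatsal/Kim — Hatley–Lei 2019 for Wach-module signed Selmer groups — moves `μ = 0` between
`3`-congruent curves, all of which share the small image). Beyond-print theorem: NO (compositions of
named facts, conditional on K1's predicate). PARTITION: 0 cells.

References: [Sprung2012] Thm. 1.2/7.14, Thm. 1.4/7.16, Main Conj. 1.3/7.21 (pp. 1486, 1504–1505);
[Wuthrich2014] Lemma 20 (p. 399); [Kato2004] Thm. 12.5 and (12.5.2); [GreenbergVatsal2000] p. 2 (1)–(2),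
§3 Rem. 3.4; [Mazur1978] Cor. 4.1; [Washington1997] §13.2; [HatleyLei2019] Ann. Inst. Fourier 69 (2019)
Thm. 4.6/5.4 (context only; nothing of it is used); files
`Theorems/SignedLowerHalvesSprungLowerDivisibilityAtThreeSurjBranch.lean` (p534029),
`Literature/…/Sprung2012/SharpFlatKatoDivisibility.lean`,
`Literature/…/BurungaleTian2026/EtaSignedMainConjectureTensorQ.lean` (§MuCriterion).
-/

set_option autoImplicit false
-- justification: the mandated namespace `Summit.BirchSwinnertonDyer.BirchSwinnertonDyer.Theorems`
-- (single-conjunct summit, Sub = Summit) repeats a segment by design (D-0017).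
set_option linter.dupNamespace false

noncomputable section

open scoped Classical NumberField MatrixGroups ModularForm
open NumberField IsDedekindDomain WeierstrassCurve CongruenceSubgroup
  Literature.NumberTheory.EllipticCurves Literature.NumberTheory.EllipticCurves.ModularForms
  Literature.NumberTheory.EllipticCurves.Rank1Residual
  Literature.NumberTheory.EllipticCurves.Sprung2017 Literature.NumberTheory.EllipticCurves.Sprung2012
  Literature.NumberTheory.EllipticCurves.ZpExtension
  Summit.BirchSwinnertonDyer.BirchSwinnertonDyer.Theorems

namespace Summit.BirchSwinnertonDyer.BirchSwinnertonDyer.Theorems.PrintX8MuReading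

open Summit.BirchSwinnertonDyer Summit.BirchSwinnertonDyer.Rank1Residual.Supersingular
  Literature.NumberTheory.EllipticCurves.BurungaleTian2026
  Literature.NumberTheory.EllipticCurves.IwasawaAlgebra

/-! ### §0. `Λ`-algebra: a divisor squeezed between `L` and `pⁿ · L` is `(p^m · L)` -/

/-- **`Λ`-rigidity with `p`-power slack.** In `Λ = ℤ_p⟦T⟧` (a UFD in which `p` is prime), if
`gen = C(u) · (L · h)` with `u ∈ ℤ_p^×` and `gen ∣ pⁿ · L` with `L ≠ 0`, then `(gen) = (p^m · L)` for
some `m ≤ n` (`h ∣ pⁿ`, so `h ~ p^m`). [cite: Washington1997, §13.2] -/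
theorem span_eq_span_pow_mul_of_dvd_pow_mul {p : ℕ} [Fact p.Prime] {gen L h : IwasawaAlgebra p}
    (u : ℤ_[p]ˣ) (hL : L ≠ 0) (hgen : gen = PowerSeries.C (u : ℤ_[p]) * (L * h)) {n : ℕ}
    (hKato : gen ∣ (p : IwasawaAlgebra p) ^ n * L) :
    ∃ m ≤ n, Ideal.span ({gen} : Set (IwasawaAlgebra p)) =
      Ideal.span {(p : IwasawaAlgebra p) ^ m * L} := by
  have hgen' : gen = (PowerSeries.C (u : ℤ_[p]) * h) * L := by rw [hgen]; ring
  have h1 : PowerSeries.C (u : ℤ_[p]) * h ∣ (p : IwasawaAlgebra p) ^ n := by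
    rw [hgen'] at hKato
    exact (mul_dvd_mul_iff_right hL).mp hKato
  have hpC : (p : IwasawaAlgebra p) = PowerSeries.C (p : ℤ_[p]) := (map_natCast _ p).symm
  rw [hpC] at h1
  obtain ⟨m, hmn, hassoc⟩ := (dvd_prime_pow (prime_C p) n).mp h1
  refine ⟨m, hmn, ?_⟩
  rw [hgen', hpC]
  exact Ideal.span_singleton_eq_span_singleton.mpr (hassoc.mul_right L)

/-- **`μ` of a module with `char = (p^m · L)`**: `μ(M) = m + μ(Λ/(L))` (`M` finitely generated torsion,
`L ≠ 0`). [cite: Washington1997, §13.2] -/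
theorem muInvariant_eq_add_of_charIdeal_eq_span_pow_mul {p : ℕ} [Fact p.Prime] (M : Type)
    [AddCommGroup M] [Module (IwasawaAlgebra p) M] [Module.Finite (IwasawaAlgebra p) M]
    (hM : Module.IsTorsion (IwasawaAlgebra p) M) {L : IwasawaAlgebra p} (hL : L ≠ 0) {m : ℕ}
    (hchar : Literature.NumberTheory.EllipticCurves.Module.charIdeal (IwasawaAlgebra p) M =
      Ideal.span {(p : IwasawaAlgebra p) ^ m * L}) :
    muInvariant p M = m + muInvariant p (IwasawaAlgebra p ⧸ Ideal.span {L}) := by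
  rw [muInvariant_eq_muInvariant_quotient_of_charIdeal_eq_span M hM hchar,
    muInvariant_quotient_pow_mul hL m]


/-! ### §1. Per pair, ANY `3`-adic image: K1's predicate + Kato's RATIONAL divisibility pin
`char X^•(E/ℚ_∞)` to `(3^m · L^•_3(E))` -/

section PerPair


/-- **X8, ANY image, colour `•`: K1's predicate ⇒ `char X^•(E/ℚ_∞) = (p^m · L^•_p(E))` EXACTLY for
some `m ≥ 0`.** Inputs BY NAME: Sprung 2012 Thm. 7.14 (`h714`, torsion), Thm. 7.16 FIRST clause
(`h716`, Kato: `gen ∣ pⁿ · L^•` for some `n` — NO hypothesis on the Galois image), the period unit at `3`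
(`h3`, `ϖ ∈ ℤ_3^×`). With K1 (`ϖ L^• · h = gen`): `L^• h ∣ 3ⁿ L^•`, so `h ∣ 3ⁿ`, so `h ~ 3^m` (`3` is
prime in `Λ`). On the 156 big-image cells `m = 0` (Thm. 7.16 second clause, file
`…SprungLowerDivisibilityAtThreeSurjBranch`); on the 61 cells with image `N_ns(3)` the exponent `m` IS the
residual. PER PAIR; conditional on K1's predicate; closes nothing.
[cite: Sprung2012, Thm. 7.14 and Thm. 7.16 (p. 1504), Main Conj. 7.21 (p. 1505)] [cite: Washington1997, §13.2] -/
theorem X8.exists_charIdeal_eq_span_pow_mul_of_lowerDivisibility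
    (h714 : thm714_sharpFlatSelmerDual_finite_torsion)
    (h716 : thm716_sharpFlatCharIdeal_divisibility)
    (h3 : realPeriodRat_eq_unit_mul_plusPeriod_three)
    (W : WeierstrassCurve ℚ) [W.IsElliptic] [W.IsGloballyMinimal] (p : ℕ) [Fact p.Prime]
    (hX : ClassX8 W p) (col : Chroma) (hK1 : SprungSharpFlatLowerDivisibility W p col)
    {κ : ZpExtension ℚ p} {γ : Field.absoluteGaloisGroup ℚ} (hκ : κ.IsCyclotomic)
    (hγ : κ.IsTopGenerator γ) (hγ' : IsCyclotomicVariable p γ)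
    {v : HeightOneSpectrum (𝓞 ℚ)} (hv : (p : 𝓞 ℚ) ∈ v.asIdeal)
    {g : Field.absoluteGaloisGroup (v.adicCompletion ℚ)}
    (hg : κ.IsTopGenerator (resGalOfEmb (closureEmb (K := ℚ) (v.adicCompletion ℚ)) g))
    {cneg : localPoints W (v.adicCompletion ℚ)} {c : ℕ → localPoints W (v.adicCompletion ℚ)}
    (hc : IsHondaSystem κ (closureEmb (K := ℚ) (v.adicCompletion ℚ)) W (W.frobeniusTrace p) g cneg c)
    {N : ℕ} [hN : NeZero N] {f : CuspForm (Gamma0 N) 2} {ϖ : ℚ} {Lsharp Lflat : IwasawaAlgebra p}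
    (hf : IsNewformOf W f) (hϖ : (ϖ : ℝ) * W.realPeriodRat = plusPeriod f)
    (hSP : IsSprungPair f p (W.frobeniusTrace p) Lsharp Lflat)
    (hcol : chromaticL col Lsharp Lflat ≠ 0)
    (D : SharpFlatSelmerDualData W κ γ (closureEmb (K := ℚ) (v.adicCompletion ℚ))
      (W.frobeniusTrace p) g c col) :
    Module.IsTorsion (IwasawaAlgebra p) D.X ∧ Module.Finite (IwasawaAlgebra p) D.X ∧
      ∃ m : ℕ, D.charIdeal =
        Ideal.span {(p : IwasawaAlgebra p) ^ m * chromaticL col Lsharp Lflat} := by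
  have hp3 : p = 3 := hX.1
  subst hp3
  have hp2 : (3 : ℕ) ≠ 2 := by decide
  have hgood : W.HasGoodReductionAtPrime 3 := hX.2.1.1
  have hdvd : ((3 : ℕ) : ℤ) ∣ W.frobeniusTrace 3 := hX.2.1.2
  -- Sprung 2012 Thm. 7.14: `X^•` finitely generated and `Λ`-torsion
  obtain ⟨hfinD, htorD⟩ :=
    h714 W 3 hp2 hgood hdvd f hf κ γ hκ hγ hγ' v hv g hg cneg c hc col Lsharp Lflat hSP hcol D
  haveI := hfinD
  -- K1 at the pair: `char X^• = (gen)`, `ι gen = ϖ · ι(L^• · h)`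
  obtain ⟨gen, h, hchar, hι⟩ :=
    hK1 κ γ hκ hγ hγ' v hv g hg cneg c hc N hN f ϖ Lsharp Lflat hf hϖ hSP hcol D
  -- Kato (Sprung 2012 Thm. 7.16, FIRST clause, no image hypothesis): `gen ∣ 3ⁿ · L^•`
  obtain ⟨n, hn⟩ :=
    h716.exists_dvd_pow_mul hp2 hgood hdvd hf hκ hγ hγ' hv hg hc hSP hcol D htorD hchar
  -- `ϖ ∈ ℤ_3^×`
  have hϖ1 : ‖(ϖ : ℚ_[3])‖ = 1 := X8_norm_periodRatio_eq_one h3 W 3 hX hf hϖ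
  obtain ⟨-, hι'⟩ := span_C_units_mul_eq (PadicInt.mkUnits hϖ1) (chromaticL col Lsharp Lflat * h)
  have hgen_eq : gen = PowerSeries.C ((PadicInt.mkUnits hϖ1 : ℤ_[3]ˣ) : ℤ_[3]) *
      (chromaticL col Lsharp Lflat * h) := by
    apply iwasawaToPowerSeries_injective 3
    rw [hι, hι', PadicInt.mkUnits_eq]
  obtain ⟨m, -, hspan⟩ :=
    span_eq_span_pow_mul_of_dvd_pow_mul (PadicInt.mkUnits hϖ1) hcol hgen_eq hn
  exact ⟨htorD, hfinD, m, hchar.trans hspan⟩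

/-- **The `μ`-count**: at an X8 pair (any image), for the colour `•`, K1's predicate gives
`char X^• = (p^m · L^•)` with `μ(X^•) = m + μ(Λ/(L^•))` — in particular K1 is the `μ`-LOWER bound
`μ(Λ/(L^•)) ≤ μ(X^•)`, and `m = μ(X^•) − μ(Λ/(L^•))` is the whole residual. PER PAIR; conditional on
K1's predicate. [cite: Sprung2012, Thm. 7.14 and Thm. 7.16 (p. 1504)] [cite: Washington1997, §13.2] -/
theorem X8.exists_charIdeal_eq_and_muInvariant_eq_of_lowerDivisibility
    (h714 : thm714_sharpFlatSelmerDual_finite_torsion)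
    (h716 : thm716_sharpFlatCharIdeal_divisibility)
    (h3 : realPeriodRat_eq_unit_mul_plusPeriod_three)
    (W : WeierstrassCurve ℚ) [W.IsElliptic] [W.IsGloballyMinimal] (p : ℕ) [Fact p.Prime]
    (hX : ClassX8 W p) (col : Chroma) (hK1 : SprungSharpFlatLowerDivisibility W p col)
    {κ : ZpExtension ℚ p} {γ : Field.absoluteGaloisGroup ℚ} (hκ : κ.IsCyclotomic)
    (hγ : κ.IsTopGenerator γ) (hγ' : IsCyclotomicVariable p γ)
    {v : HeightOneSpectrum (𝓞 ℚ)} (hv : (p : 𝓞 ℚ) ∈ v.asIdeal)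
    {g : Field.absoluteGaloisGroup (v.adicCompletion ℚ)}
    (hg : κ.IsTopGenerator (resGalOfEmb (closureEmb (K := ℚ) (v.adicCompletion ℚ)) g))
    {cneg : localPoints W (v.adicCompletion ℚ)} {c : ℕ → localPoints W (v.adicCompletion ℚ)}
    (hc : IsHondaSystem κ (closureEmb (K := ℚ) (v.adicCompletion ℚ)) W (W.frobeniusTrace p) g cneg c)
    {N : ℕ} [hN : NeZero N] {f : CuspForm (Gamma0 N) 2} {ϖ : ℚ} {Lsharp Lflat : IwasawaAlgebra p}
    (hf : IsNewformOf W f) (hϖ : (ϖ : ℝ) * W.realPeriodRat = plusPeriod f)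
    (hSP : IsSprungPair f p (W.frobeniusTrace p) Lsharp Lflat)
    (hcol : chromaticL col Lsharp Lflat ≠ 0)
    (D : SharpFlatSelmerDualData W κ γ (closureEmb (K := ℚ) (v.adicCompletion ℚ))
      (W.frobeniusTrace p) g c col) :
    ∃ m : ℕ, D.charIdeal = Ideal.span {(p : IwasawaAlgebra p) ^ m * chromaticL col Lsharp Lflat} ∧
      muInvariant p D.X =
        m + muInvariant p (IwasawaAlgebra p ⧸ Ideal.span {chromaticL col Lsharp Lflat}) := by
  obtain ⟨htorD, hfinD, m, hm⟩ := X8.exists_charIdeal_eq_span_pow_mul_of_lowerDivisibility h714 h716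
    h3 W p hX col hK1 hκ hγ hγ' hv hg hc hf hϖ hSP hcol D
  haveI := hfinD
  exact ⟨m, hm, muInvariant_eq_add_of_charIdeal_eq_span_pow_mul D.X htorD hcol hm⟩

end PerPair


/-! ### §1b. The `μ`-criterion at an X8 pair: given K1, Sprung's Main Conjecture 7.21 IS the
`μ`-inequality `μ(X^•) ≤ μ(Λ/(L^•))` (any image; the image hypothesis of Thm. 7.16 enters ONLY here) -/

section MuCriterion

/-- **X8, ANY image, colour `•`: K1's predicate + `μ(X^•) ≤ μ(Λ/(L^•_p(E)))` for every datum ⇒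
Sprung's Main Conjecture 7.21 `SprungSharpFlatMainConjecture W p •`** (Néron-normalised, on the REAL
`X^•`). With §1: `char X^• = (3^m L^•)` and `μ(X^•) = m + μ(Λ/(L^•))`, so the inequality forces
`m = 0`. The `μ`-hypothesis is displayed `ϖ`-free (it does not see the period). Inputs BY NAME: Sprung
2012 Thms. 7.14 / 7.16 (first clause), period unit at `3`. PER PAIR; conditional on K1's predicate and
the displayed `μ`-bound; closes nothing. [cite: Sprung2012, Thm. 7.14, Thm. 7.16 (p. 1504) and Main Conj. 7.21 (p. 1505)]
[cite: Washington1997, §13.2] -/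
theorem X8.sprungSharpFlatMainConjecture_of_lowerDivisibility_of_muInvariant_le
    (h714 : thm714_sharpFlatSelmerDual_finite_torsion)
    (h716 : thm716_sharpFlatCharIdeal_divisibility)
    (h3 : realPeriodRat_eq_unit_mul_plusPeriod_three)
    (W : WeierstrassCurve ℚ) [W.IsElliptic] [W.IsGloballyMinimal] (p : ℕ) [Fact p.Prime]
    (hX : ClassX8 W p) (col : Chroma) (hK1 : SprungSharpFlatLowerDivisibility W p col)
    (hμ : ∀ (κ : ZpExtension ℚ p) (γ : Field.absoluteGaloisGroup ℚ),
        κ.IsCyclotomic → κ.IsTopGenerator γ → IsCyclotomicVariable p γ →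
      ∀ (v : HeightOneSpectrum (𝓞 ℚ)), (p : 𝓞 ℚ) ∈ v.asIdeal →
      ∀ (g : Field.absoluteGaloisGroup (v.adicCompletion ℚ)),
        κ.IsTopGenerator (resGalOfEmb (closureEmb (K := ℚ) (v.adicCompletion ℚ)) g) →
      ∀ (cneg : localPoints W (v.adicCompletion ℚ)) (c : ℕ → localPoints W (v.adicCompletion ℚ)),
        IsHondaSystem κ (closureEmb (K := ℚ) (v.adicCompletion ℚ)) W (W.frobeniusTrace p) g cneg c →
      ∀ (N : ℕ) (_ : NeZero N) (f : CuspForm (Gamma0 N) 2) (Lsharp Lflat : IwasawaAlgebra p),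
        IsNewformOf W f → IsSprungPair f p (W.frobeniusTrace p) Lsharp Lflat →
        chromaticL col Lsharp Lflat ≠ 0 →
      ∀ D : SharpFlatSelmerDualData W κ γ (closureEmb (K := ℚ) (v.adicCompletion ℚ))
          (W.frobeniusTrace p) g c col,
        muInvariant p D.X ≤ muInvariant p (IwasawaAlgebra p ⧸ Ideal.span {chromaticL col Lsharp Lflat})) :
    SprungSharpFlatMainConjecture W p col := by
  intro κ γ hκ hγ hγ' v hv g hg cneg c hc N hN f ϖ Lsharp Lflat hf hϖ hSP hcol D
  haveI := hN
  obtain ⟨htorD, hfinD, m, hm⟩ := X8.exists_charIdeal_eq_span_pow_mul_of_lowerDivisibility h714 h716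
    h3 W p hX col hK1 hκ hγ hγ' hv hg hc hf hϖ hSP hcol D
  haveI := hfinD
  have hμm : muInvariant p D.X =
      m + muInvariant p (IwasawaAlgebra p ⧸ Ideal.span {chromaticL col Lsharp Lflat}) :=
    muInvariant_eq_add_of_charIdeal_eq_span_pow_mul D.X htorD hcol hm
  have hle := hμ κ γ hκ hγ hγ' v hv g hg cneg c hc N hN f Lsharp Lflat hf hSP hcol D
  have hm0 : m = 0 := by omega
  rw [hm0, pow_zero, one_mul] at hm
  -- the Néron-normalised generator `ϖ̃ · L^•`
  have hϖ1 : ‖(ϖ : ℚ_[p])‖ = 1 := X8_norm_periodRatio_eq_one h3 W p hX hf hϖ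
  obtain ⟨hspan', hι''⟩ := span_C_units_mul_eq (PadicInt.mkUnits hϖ1) (chromaticL col Lsharp Lflat)
  refine ⟨htorD, PowerSeries.C ((PadicInt.mkUnits hϖ1 : ℤ_[p]ˣ) : ℤ_[p]) *
    chromaticL col Lsharp Lflat, ?_, ?_⟩
  · rw [hm, hspan']
  · rw [hι'', PadicInt.mkUnits_eq]

/-- **The `μ = 0` form.** X8, any image, colour `•`: K1's predicate + `μ(X^•(E/ℚ_∞)) = 0` for every
datum ⇒ Sprung's Main Conjecture 7.21 for `•` (then also `μ(L^•) = 0`). The `μ = 0` input is the ♯/♭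
analogue of Greenberg's `μ`-conjecture at an irreducible `E[p]` (on X8 `E[3]` is irreducible); it is
what a ♯/♭ Greenberg–Vatsal/Kim transfer from a congruent partner would deliver. PER PAIR; conditional.
[cite: Sprung2012, Thm. 7.14, Thm. 7.16 (p. 1504) and Main Conj. 7.21 (p. 1505)] [cite: GreenbergVatsal2000, p. 2, (1)–(2)] -/
theorem X8.sprungSharpFlatMainConjecture_of_lowerDivisibility_of_muInvariant_eq_zero
    (h714 : thm714_sharpFlatSelmerDual_finite_torsion)
    (h716 : thm716_sharpFlatCharIdeal_divisibility)
    (h3 : realPeriodRat_eq_unit_mul_plusPeriod_three)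
    (W : WeierstrassCurve ℚ) [W.IsElliptic] [W.IsGloballyMinimal] (p : ℕ) [Fact p.Prime]
    (hX : ClassX8 W p) (col : Chroma) (hK1 : SprungSharpFlatLowerDivisibility W p col)
    (hμ0 : ∀ (κ : ZpExtension ℚ p) (γ : Field.absoluteGaloisGroup ℚ),
        κ.IsCyclotomic → κ.IsTopGenerator γ → IsCyclotomicVariable p γ →
      ∀ (v : HeightOneSpectrum (𝓞 ℚ)), (p : 𝓞 ℚ) ∈ v.asIdeal →
      ∀ (g : Field.absoluteGaloisGroup (v.adicCompletion ℚ)),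
        κ.IsTopGenerator (resGalOfEmb (closureEmb (K := ℚ) (v.adicCompletion ℚ)) g) →
      ∀ (cneg : localPoints W (v.adicCompletion ℚ)) (c : ℕ → localPoints W (v.adicCompletion ℚ)),
        IsHondaSystem κ (closureEmb (K := ℚ) (v.adicCompletion ℚ)) W (W.frobeniusTrace p) g cneg c →
      ∀ (N : ℕ) (_ : NeZero N) (f : CuspForm (Gamma0 N) 2) (Lsharp Lflat : IwasawaAlgebra p),
        IsNewformOf W f → IsSprungPair f p (W.frobeniusTrace p) Lsharp Lflat →
        chromaticL col Lsharp Lflat ≠ 0 →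
      ∀ D : SharpFlatSelmerDualData W κ γ (closureEmb (K := ℚ) (v.adicCompletion ℚ))
          (W.frobeniusTrace p) g c col,
        muInvariant p D.X = 0) :
    SprungSharpFlatMainConjecture W p col :=
  X8.sprungSharpFlatMainConjecture_of_lowerDivisibility_of_muInvariant_le h714 h716 h3 W p hX col hK1
    fun κ γ hκ hγ hγ' v hv g hg cneg c hc N hN f Lsharp Lflat hf hSP hcol D ↦ by
      rw [hμ0 κ γ hκ hγ hγ' v hv g hg cneg c hc N hN f Lsharp Lflat hf hSP hcol D]; exact Nat.zero_le _

/-- **Conversely (no K1 needed): Sprung's Main Conjecture 7.21 for `•` ⇒ the `μ`-EQUALITY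
`μ(X^•) = μ(Λ/(L^•))` for every datum** (the characteristic ideal IS `(ϖ̃ L^•)`, `ϖ̃` a unit; a rational
period ratio exists by the period fact at `3`). PER PAIR. [cite: Sprung2012, Main Conj. 7.21 (p. 1505)]
[cite: Washington1997, §13.2] -/
theorem X8.muInvariant_eq_of_sprungSharpFlatMainConjecture
    (h714 : thm714_sharpFlatSelmerDual_finite_torsion)
    (h3 : realPeriodRat_eq_unit_mul_plusPeriod_three)
    (W : WeierstrassCurve ℚ) [W.IsElliptic] [W.IsGloballyMinimal] (p : ℕ) [Fact p.Prime]
    (hX : ClassX8 W p) (col : Chroma) (hMC : SprungSharpFlatMainConjecture W p col) :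
    ∀ (κ : ZpExtension ℚ p) (γ : Field.absoluteGaloisGroup ℚ),
        κ.IsCyclotomic → κ.IsTopGenerator γ → IsCyclotomicVariable p γ →
      ∀ (v : HeightOneSpectrum (𝓞 ℚ)), (p : 𝓞 ℚ) ∈ v.asIdeal →
      ∀ (g : Field.absoluteGaloisGroup (v.adicCompletion ℚ)),
        κ.IsTopGenerator (resGalOfEmb (closureEmb (K := ℚ) (v.adicCompletion ℚ)) g) →
      ∀ (cneg : localPoints W (v.adicCompletion ℚ)) (c : ℕ → localPoints W (v.adicCompletion ℚ)),
        IsHondaSystem κ (closureEmb (K := ℚ) (v.adicCompletion ℚ)) W (W.frobeniusTrace p) g cneg c →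
      ∀ (N : ℕ) (_ : NeZero N) (f : CuspForm (Gamma0 N) 2) (Lsharp Lflat : IwasawaAlgebra p),
        IsNewformOf W f → IsSprungPair f p (W.frobeniusTrace p) Lsharp Lflat →
        chromaticL col Lsharp Lflat ≠ 0 →
      ∀ D : SharpFlatSelmerDualData W κ γ (closureEmb (K := ℚ) (v.adicCompletion ℚ))
          (W.frobeniusTrace p) g c col,
        muInvariant p D.X = muInvariant p (IwasawaAlgebra p ⧸ Ideal.span {chromaticL col Lsharp Lflat}) := by
  intro κ γ hκ hγ hγ' v hv g hg cneg c hc N hN f Lsharp Lflat hf hSP hcol D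
  haveI := hN
  have hp3 : p = 3 := hX.1
  subst hp3
  have hp2 : (3 : ℕ) ≠ 2 := by decide
  have hgood : W.HasGoodReductionAtPrime 3 := hX.2.1.1
  have hdvd : ((3 : ℕ) : ℤ) ∣ W.frobeniusTrace 3 := hX.2.1.2
  -- a RATIONAL period ratio `ϖ` with `ϖ · Ω_W = Ω⁺_f` (period fact at `3`: `Ω_W = u · Ω⁺_f`, `|u|₃ = 1`)
  obtain ⟨u, hu1, hΩ⟩ := h3 W hgood (ClassX8.irr W 3 hX) f hf
  have hu0 : u ≠ 0 := by
    intro h0; rw [h0] at hu1; simp at hu1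
  have hϖ : ((u⁻¹ : ℚ) : ℝ) * W.realPeriodRat = plusPeriod f := by
    rw [hΩ]; push_cast; field_simp
  obtain ⟨hfinD, htorD⟩ :=
    h714 W 3 hp2 hgood hdvd f hf κ γ hκ hγ hγ' v hv g hg cneg c hc col Lsharp Lflat hSP hcol D
  haveI := hfinD
  obtain ⟨-, gen, hchar, hι⟩ :=
    hMC κ γ hκ hγ hγ' v hv g hg cneg c hc N hN f u⁻¹ Lsharp Lflat hf hϖ hSP hcol D
  have hϖ1 : ‖((u⁻¹ : ℚ) : ℚ_[3])‖ = 1 := X8_norm_periodRatio_eq_one h3 W 3 hX hf hϖ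
  obtain ⟨hspan', hι'⟩ := span_C_units_mul_eq (PadicInt.mkUnits hϖ1) (chromaticL col Lsharp Lflat)
  have hgen_eq : gen = PowerSeries.C ((PadicInt.mkUnits hϖ1 : ℤ_[3]ˣ) : ℤ_[3]) *
      chromaticL col Lsharp Lflat := by
    apply iwasawaToPowerSeries_injective 3
    rw [hι, hι', PadicInt.mkUnits_eq]
  have hchar' : D.charIdeal = Ideal.span {chromaticL col Lsharp Lflat} := by
    rw [hchar, hgen_eq, hspan']
  exact muInvariant_eq_muInvariant_quotient_of_charIdeal_eq_span D.X htorD hchar'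

/-- **The `μ`-criterion (iff).** At an X8 pair (any image), colour `•`, GIVEN K1's predicate and the
three published inputs: Sprung's Main Conjecture 7.21 for `•` ⟺ `μ(X^•) ≤ μ(Λ/(L^•))` for every datum
⟺ `μ(X^•) = μ(Λ/(L^•))` for every datum. READING for the small-image crux: on the 61 X8 cells with
image `N_ns(3)` the residual beyond K1 is a statement about `μ`-invariants ONLY (the `λ`-invariants and
the distinguished parts already agree). [cite: Sprung2012, Thm. 7.14, Thm. 7.16 (p. 1504) and Main Conj. 7.21 (p. 1505)]
[cite: Washington1997, §13.2] -/
theorem X8.sprungSharpFlatMainConjecture_iff_muInvariant_le_of_lowerDivisibility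
    (h714 : thm714_sharpFlatSelmerDual_finite_torsion)
    (h716 : thm716_sharpFlatCharIdeal_divisibility)
    (h3 : realPeriodRat_eq_unit_mul_plusPeriod_three)
    (W : WeierstrassCurve ℚ) [W.IsElliptic] [W.IsGloballyMinimal] (p : ℕ) [Fact p.Prime]
    (hX : ClassX8 W p) (col : Chroma) (hK1 : SprungSharpFlatLowerDivisibility W p col) :
    (SprungSharpFlatMainConjecture W p col ↔
      ∀ (κ : ZpExtension ℚ p) (γ : Field.absoluteGaloisGroup ℚ),
          κ.IsCyclotomic → κ.IsTopGenerator γ → IsCyclotomicVariable p γ →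
        ∀ (v : HeightOneSpectrum (𝓞 ℚ)), (p : 𝓞 ℚ) ∈ v.asIdeal →
        ∀ (g : Field.absoluteGaloisGroup (v.adicCompletion ℚ)),
          κ.IsTopGenerator (resGalOfEmb (closureEmb (K := ℚ) (v.adicCompletion ℚ)) g) →
        ∀ (cneg : localPoints W (v.adicCompletion ℚ)) (c : ℕ → localPoints W (v.adicCompletion ℚ)),
          IsHondaSystem κ (closureEmb (K := ℚ) (v.adicCompletion ℚ)) W (W.frobeniusTrace p) g cneg c →
        ∀ (N : ℕ) (_ : NeZero N) (f : CuspForm (Gamma0 N) 2) (Lsharp Lflat : IwasawaAlgebra p),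
          IsNewformOf W f → IsSprungPair f p (W.frobeniusTrace p) Lsharp Lflat →
          chromaticL col Lsharp Lflat ≠ 0 →
        ∀ D : SharpFlatSelmerDualData W κ γ (closureEmb (K := ℚ) (v.adicCompletion ℚ))
            (W.frobeniusTrace p) g c col,
          muInvariant p D.X ≤ muInvariant p (IwasawaAlgebra p ⧸ Ideal.span {chromaticL col Lsharp Lflat})) ∧
    (SprungSharpFlatMainConjecture W p col ↔
      ∀ (κ : ZpExtension ℚ p) (γ : Field.absoluteGaloisGroup ℚ),
          κ.IsCyclotomic → κ.IsTopGenerator γ → IsCyclotomicVariable p γ →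
        ∀ (v : HeightOneSpectrum (𝓞 ℚ)), (p : 𝓞 ℚ) ∈ v.asIdeal →
        ∀ (g : Field.absoluteGaloisGroup (v.adicCompletion ℚ)),
          κ.IsTopGenerator (resGalOfEmb (closureEmb (K := ℚ) (v.adicCompletion ℚ)) g) →
        ∀ (cneg : localPoints W (v.adicCompletion ℚ)) (c : ℕ → localPoints W (v.adicCompletion ℚ)),
          IsHondaSystem κ (closureEmb (K := ℚ) (v.adicCompletion ℚ)) W (W.frobeniusTrace p) g cneg c →
        ∀ (N : ℕ) (_ : NeZero N) (f : CuspForm (Gamma0 N) 2) (Lsharp Lflat : IwasawaAlgebra p),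
          IsNewformOf W f → IsSprungPair f p (W.frobeniusTrace p) Lsharp Lflat →
          chromaticL col Lsharp Lflat ≠ 0 →
        ∀ D : SharpFlatSelmerDualData W κ γ (closureEmb (K := ℚ) (v.adicCompletion ℚ))
            (W.frobeniusTrace p) g c col,
          muInvariant p D.X = muInvariant p (IwasawaAlgebra p ⧸ Ideal.span {chromaticL col Lsharp Lflat})) := by
  refine ⟨⟨fun hMC κ γ hκ hγ hγ' v hv g hg cneg c hc N hN f Lsharp Lflat hf hSP hcol D ↦
      (X8.muInvariant_eq_of_sprungSharpFlatMainConjecture h714 h3 W p hX col hMC κ γ hκ hγ hγ' v hv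
        g hg cneg c hc N hN f Lsharp Lflat hf hSP hcol D).le,
    X8.sprungSharpFlatMainConjecture_of_lowerDivisibility_of_muInvariant_le h714 h716 h3 W p hX col
      hK1⟩, ⟨X8.muInvariant_eq_of_sprungSharpFlatMainConjecture h714 h3 W p hX col,
    fun hμ ↦ X8.sprungSharpFlatMainConjecture_of_lowerDivisibility_of_muInvariant_le h714 h716 h3 W p
      hX col hK1 fun κ γ hκ hγ hγ' v hv g hg cneg c hc N hN f Lsharp Lflat hf hSP hcol D ↦
        (hμ κ γ hκ hγ hγ' v hv g hg cneg c hc N hN f Lsharp Lflat hf hSP hcol D).le⟩⟩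

end MuCriterion


end Summit.BirchSwinnertonDyer.BirchSwinnertonDyer.Theorems.PrintX8MuReading

end
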